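import Mathlib
import Summits.MatrixMultiplication.MatrixMultiplication.Theses.SemilatticeSTPP

/-!
# Line `registered` of crux `SemilatticeSTPP.Thesis` (stmt-MatrixMultiplication-5969):
# WLOG a semilattice host is the down-set of the γ-values plus at most one top element

Hosts of the crux include SEMILATTICES = commutative idempotent monoids (product = join, identity =
bottom), with the natural order `v ≤ w :↔ v * w = w`; so `w * γ z = γ z` reads `w ≤ γ z`.

`exists_downset_host_of_idempotent`: if a finite semilattice `M` hosts a monoid-TPP family (iff form)
`(α, β, γ)`, then so does a finite semilattice `Q` with
`|Q| ≤ #{w : ∃ z, w * γ z = γ z} + 1`, i.e. of size at most the down-set `D` of the γ-values plus one.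

Proof (a Rees-type quotient).  The complement `U` of `D` is absorbing: `w ∈ U ⇒ w * v ∈ U` for every
`v` (`upset_mul_of_idempotent`: if `w * v ≤ γ z` then `w ≤ γ z`, because `w ≤ w * v` by idempotency and
`≤` is transitive).  Hence `v ~ w :↔ v = w ∨ (v ∈ U ∧ w ∈ U)` is a congruence (`Con M`), and
`Q := M/~` is a finite commutative idempotent monoid.  Push `α, β, γ` to `Q`.  The TPP iff survives:
(←) is `map_mul`; for (→), `[α x * β y] = [γ z]` means `α x * β y = γ z` (then the `M`-iff applies) or
both lie in `U` -- impossible since `γ z * γ z = γ z` puts `γ z ∈ D`.  Finally the classes of `~` are the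
singletons `{w}`, `w ∈ D`, together with (at most) the single class `U`, so
`Option D ↠ Q`, `some w ↦ [w]`, `none ↦ [u₀]` (`u₀ ∈ U` if `U ≠ ∅`) is onto and
`|Q| ≤ |D| + 1` (`Fintype.card_le_of_surjective`, `Fintype.card_option`, `Fintype.card_coe`).

Mathlib (`Mathlib.GroupTheory.Congruence`: `Con`, `Con.Quotient`, `Con.eq`, `Con.mk'_surjective`) + the
route file only; no cited facts; sorry-free.
-/

set_option linter.dupNamespace false
-- (single-conjunct summit: the namespace repeats `MatrixMultiplication`)

namespace Summit.MatrixMultiplication.MatrixMultiplication.Theorems.SemilatticeSTPPThesis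

/-- In a commutative idempotent monoid the complement of the down-set of a family `γ` is absorbing:
if `w * γ z ≠ γ z` for every `z` (`w ≰ γ z`), then also `(w * v) * γ z ≠ γ z` for every `v` and `z`,
because `w ≤ w * v` (`w * (w * v) = w * v` by idempotency) and `≤` is transitive
(`w * γ z = w * (w * v * γ z) = (w * w) * v * γ z = γ z`). [folklore] -/
theorem upset_mul_of_idempotent {M : Type} [CommMonoid M] (hid : ∀ v : M, v * v = v) {ι : Type}
    (γ : ι → M) {w : M} (v : M) (hw : ¬ ∃ z, w * γ z = γ z) : ¬ ∃ z, w * v * γ z = γ z := by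
  rintro ⟨z, hz⟩
  refine hw ⟨z, ?_⟩
  calc w * γ z = w * (w * v * γ z) := by rw [hz]
    _ = w * w * v * γ z := by simp only [mul_assoc]
    _ = γ z := by rw [hid w, hz]

/-- **WLOG the semilattice host is the down-set of the γ-values plus at most one extra (top) element.**
If a finite commutative idempotent monoid `M` hosts a monoid-TPP family `(α, β, γ)` (iff form), then some
finite commutative idempotent monoid `Q` with `|Q| ≤ #{w : ∃ z, w * γ z = γ z} + 1` hosts a family with the
same parameters: `Q` is the quotient of `M` by the congruence collapsing the (absorbing) complement `U` of
the down-set of the γ-values to one point; the TPP iff transfers because every `γ z` lies in the down-set,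
and the classes are the singletons of the down-set plus at most the class `U`. [folklore: Rees quotient] -/
theorem exists_downset_host_of_idempotent :
    ∀ (M : Type) [CommMonoid M] [Fintype M] [DecidableEq M], (∀ v : M, v * v = v) →
      ∀ (p : ℕ) (a b c : Fin p → ℕ) (α : (Σ i, Fin (a i) × Fin (b i)) → M)
        (β : (Σ i, Fin (b i) × Fin (c i)) → M) (γ : (Σ i, Fin (a i) × Fin (c i)) → M),
        (∀ x y z, α x * β y = γ z ↔
          (z.1 = x.1 ∧ x.1 = y.1 ∧ (z.2.1 : ℕ) = x.2.1 ∧ (x.2.2 : ℕ) = y.2.1 ∧ (z.2.2 : ℕ) = y.2.2)) →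
        ∃ (Q : Type) (_ : CommMonoid Q) (_ : Fintype Q), (∀ v : Q, v * v = v) ∧
          ∃ (α' : (Σ i, Fin (a i) × Fin (b i)) → Q) (β' : (Σ i, Fin (b i) × Fin (c i)) → Q)
            (γ' : (Σ i, Fin (a i) × Fin (c i)) → Q),
            (∀ x y z, α' x * β' y = γ' z ↔
              (z.1 = x.1 ∧ x.1 = y.1 ∧ (z.2.1 : ℕ) = x.2.1 ∧ (x.2.2 : ℕ) = y.2.1 ∧ (z.2.2 : ℕ) = y.2.2)) ∧
            Fintype.card Q ≤
              (Finset.univ.filter fun w : M => ∃ z : (Σ i, Fin (a i) × Fin (c i)), w * γ z = γ z).card + 1 := by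
  intro M _ _ _ hid p a b c α β γ hγ
  -- `D w` : `w` lies in the down-set of the γ-values (`w ≤ γ z` for some `z`); `U := ¬ D` is absorbing.
  let D : M → Prop := fun w => ∃ z : (Σ i, Fin (a i) × Fin (c i)), w * γ z = γ z
  have hUl : ∀ w v : M, ¬ D w → ¬ D (w * v) := fun w v hw => upset_mul_of_idempotent hid γ v hw
  have hUr : ∀ v w : M, ¬ D w → ¬ D (v * w) := fun v w hw => mul_comm w v ▸ hUl w v hw
  -- the congruence collapsing `U` to a single point (a Rees-type quotient)
  let cg : Con M :=
    { r := fun v w => v = w ∨ (¬ D v ∧ ¬ D w)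
      iseqv :=
        { refl := fun v => Or.inl rfl
          symm := fun {v w} h => by
            rcases h with rfl | h
            · exact Or.inl rfl
            · exact Or.inr ⟨h.2, h.1⟩
          trans := fun {u v w} h₁ h₂ => by
            rcases h₁ with rfl | h₁
            · exact h₂
            · rcases h₂ with rfl | h₂
              · exact Or.inr h₁
              · exact Or.inr ⟨h₁.1, h₂.2⟩ }
      mul' := fun {w x y z} h₁ h₂ => by
        rcases h₁ with rfl | h₁
        · rcases h₂ with rfl | h₂
          · exact Or.inl rfl
          · exact Or.inr ⟨hUr _ _ h₂.1, hUr _ _ h₂.2⟩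
        · exact Or.inr ⟨hUl _ _ h₁.1, hUl _ _ h₁.2⟩ }
  have hcg : ∀ v w : M, cg v w ↔ (v = w ∨ (¬ D v ∧ ¬ D w)) := fun _ _ => Iff.rfl
  haveI : Finite cg.Quotient := Finite.of_surjective _ (Con.mk'_surjective (c := cg))
  letI : Fintype cg.Quotient := Fintype.ofFinite _
  refine ⟨cg.Quotient, inferInstance, inferInstance, ?_, fun x => (α x : cg.Quotient),
    fun y => (β y : cg.Quotient), fun z => (γ z : cg.Quotient), ?_, ?_⟩
  · -- idempotency survives in the quotient
    intro v
    induction v using Con.induction_on with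
    | H v => exact (Con.coe_mul v v).symm.trans (congrArg _ (hid v))
  · -- the monoid TPP (iff form) survives: `γ z ∈ D`, so the class of `γ z` is a singleton
    intro x y z
    change ((α x * β y : M) : cg.Quotient) = ↑(γ z) ↔ _
    rw [Con.eq, hcg, hγ x y z]
    exact ⟨fun h => h.elim id fun h => (h.2 ⟨z, hid (γ z)⟩).elim, Or.inl⟩
  · -- cardinality: the classes are the singletons `{w}`, `w ∈ D`, plus (at most) the class `U`
    suffices h : ∀ S : Finset M, (∀ w, D w → w ∈ S) → Fintype.card cg.Quotient ≤ S.card + 1 from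
      h _ fun w hw => Finset.mem_filter.2 ⟨Finset.mem_univ _, hw⟩
    intro S hS
    obtain ⟨u₀, hu₀⟩ : ∃ u₀ : M, ∀ u, ¬ D u → cg u u₀ := by
      by_cases h : ∃ u, ¬ D u
      · exact ⟨h.choose, fun u hu => Or.inr ⟨hu, h.choose_spec⟩⟩
      · push Not at h
        exact ⟨1, fun u hu => (hu (h u)).elim⟩
    let f : Option S → cg.Quotient := fun o => o.elim (u₀ : cg.Quotient) fun w => (w.1 : cg.Quotient)
    have hf : Function.Surjective f := by
      intro q
      induction q using Con.induction_on with
      | H v =>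
        by_cases hv : D v
        · exact ⟨some ⟨v, hS v hv⟩, rfl⟩
        · exact ⟨none, cg.eq.2 (cg.symm (hu₀ v hv))⟩
    calc Fintype.card cg.Quotient ≤ Fintype.card (Option S) := Fintype.card_le_of_surjective f hf
      _ = S.card + 1 := by rw [Fintype.card_option, Fintype.card_coe]

end Summit.MatrixMultiplication.MatrixMultiplication.Theorems.SemilatticeSTPPThesis
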